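import Literature.AlgebraicGeometry.Resolution.CentreBlowupMohStability
import Literature.AlgebraicGeometry.Resolution.CentreBlowupOrdAlongBasics
import Mathlib.Algebra.CharP.Lemmas
import HarnessLib

/-!
# Purely inseparable four-folds — blow-up steps at points ALONG a coordinate centre (PR-1 (i))

[OURS · counted 0 · cell `res-dim4-pi`, D-0157 DOOR 2, brick PR-1; AI work, weaker than expert review]
Nothing in this file is a statement about resolution of singularities (dimension `≥ 4`,
characteristic `p`: NOT proved anywhere in this programme); it is elementary support bookkeeping in
the tree's coordinate-centre model `CentreBlowup` of `PointBlowupShadeCentres.lean`.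

The tree's Moh files (`CentreBlowupMohStability.lean`: `lift_step_F`, `mohBound_one`,
`shade_le_shade_add_one_along`) read the blow-up of the centre `C_S = {x = 0, y_i = 0 (i ∈ S)}` in
the chart `y_j` (`j ∈ S`) only at points `b` of the FIBRE OVER THE ORIGIN (`b_i = 0` for `i ∉ S`).
A general closed point of the new exceptional hyperplane is `b = b' + c` with `b'` supported in
`S ∖ {j}` (the fibre coordinate) and `c` supported off `S` (the point `c ∈ C_S` it lies over). This
file proves the dictionary the cell's engines use for such "translated" edges (`t = c ≠ 0`):

* §1 `chartTransform_translate` — a translation `y_i ↦ y_i + c_i` (`i ∉ S`) ALONG the centre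
  commutes with the `C_S`-chart transform (`j ∈ S`); `ordAlong_translate` (+ `_deletePthPowers_`):
  the order along `C_S` is unchanged by it (and by the re-cleaning, for a clean `F`).
* §2–3 `step_add_eq_step_translate` — **the step at `b' + c` is the step at the fibre point `b'` of
  the state moved to `c`**, `step q S j (b' + c) s = step q S j b' ⟨translate c F, r|_{c=0}, exc|_{c=0}⟩`
  (every field, every `q`, no permissibility needed); `step_add_eq_step_translate_clean` — the same
  with the moved state RE-CLEANED (`q = pⁿ`, characteristic `p`, `F` clean: cleaning the input of a
  step does not change its cleaned output, `deletePthPowers_translate_chartTransform_deletePthPowers`).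

The moved-and-re-cleaned state is written out in every statement (no new definition, as for the
map `φ` of `CentreBlowupMohStability.lean`). Sequel: `PurelyInseparableDim4MohAlongBound` (Moh's `+1`
at translated points relative to the shade AT `c`; arbitrary points via `S.piecewise`).

bears_on: LADDER-RESOLUTION:D157-DOOR2 (res-dim4-pi · PR-1). Supports
stmt-ResolutionOfSingularities-16155 (helper).
-/

set_option linter.dupNamespace false

noncomputable section

open MvPolynomial Finset

open scoped BigOperators

namespace Summit.ResolutionOfSingularities.ResolutionOfSingularities.Theorems.PIDim4

open Literature.AlgebraicGeometry.Resolution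
open Literature.AlgebraicGeometry.Resolution.Hauser2010
open Literature.AlgebraicGeometry.Resolution.CentreBlowup
open Literature.Barriers.ResolutionOfSingularities

namespace MohAlong

/-! ## 1. Translations along the centre: algebra -/

section OffS

variable {σ : Type*} {K : Type*} [Field K] [Fintype σ] [DecidableEq σ]

omit [Fintype σ] in
/-- The chart law is additive against an exponent supported off `S` (`j ∈ S`):
`(e + k)^S = e^S + k`. [folklore] -/
theorem chartExponent_add_offS {S : Finset σ} {j : σ} (hj : j ∈ S) (q : ℕ) (e k : σ →₀ ℕ)
    (hk : ∀ i ∈ S, k i = 0) : chartExponent q S j (e + k) = chartExponent q S j e + k := by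
  ext i
  simp only [Finsupp.add_apply, chartExponent_apply, degIn_add, degIn_eq_zero_iff.mpr hk]
  split_ifs with hi
  · rw [hi, hk j hj]; omega
  · rfl

omit [DecidableEq σ] in
/-- A translation fixes a monomial none of whose variables it moves. [folklore] -/
theorem translate_monomial_eq_self (c : σ → K) (d : σ →₀ ℕ) (a : K)
    (h : ∀ i, c i = 0 ∨ d i = 0) : PointBlowup.translate c (monomial d a) = monomial d a := by
  classical
  rw [WeightedBlowup.translate_monomial]
  have hfac : ∀ i, (X i + C (c i) : MvPolynomial σ K) ^ (d i) = X i ^ (d i) := fun i => by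
    rcases h i with h0 | h0 <;> simp [h0]
  simp_rw [hfac]
  rw [MvPolynomial.monomial_eq, Finsupp.prod_fintype _ _ (fun i => pow_zero _)]

omit [Fintype σ] [DecidableEq σ] in
/-- Translations are multiplicative. [folklore] -/
theorem translate_mul (c : σ → K) (P Q : MvPolynomial σ K) :
    PointBlowup.translate c (P * Q) = PointBlowup.translate c P * PointBlowup.translate c Q := by
  unfold PointBlowup.translate
  rw [map_mul]

omit [Fintype σ] [DecidableEq σ] in
/-- Translations are additive. [folklore] -/
theorem translate_add (c : σ → K) (P Q : MvPolynomial σ K) :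
    PointBlowup.translate c (P + Q) = PointBlowup.translate c P + PointBlowup.translate c Q := by
  unfold PointBlowup.translate
  rw [map_add]

omit [Fintype σ] [DecidableEq σ] in
/-- **Translations compose additively**: `translate b ∘ translate c = translate (b + c)`. [folklore] -/
theorem translate_translate (b c : σ → K) (P : MvPolynomial σ K) :
    PointBlowup.translate b (PointBlowup.translate c P) = PointBlowup.translate (b + c) P := by
  unfold PointBlowup.translate
  rw [← AlgHom.comp_apply, MvPolynomial.comp_aeval]
  have h : (fun i => aeval (fun i => (X i + C (b i) : MvPolynomial σ K))
      (X i + C (c i) : MvPolynomial σ K)) = fun i => (X i + C ((b + c) i) : MvPolynomial σ K) := by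
    funext i
    rw [map_add, aeval_X, algHom_C, algebraMap_eq, Pi.add_apply, C_add, add_assoc]
  rw [h]

omit [Fintype σ] in
/-- **The chart transform is multiplicative against a factor supported off `S`** (`j ∈ S`): the
substitution `y_i ↦ y_j y_i` (`i ∈ S ∖ j`) and the division by `y_j^q` do not see the variables off `S`.
[folklore] -/
theorem chartTransform_mul_offS {S : Finset σ} {j : σ} (hj : j ∈ S) (q : ℕ) (P Q : MvPolynomial σ K)
    (hQ : ∀ k ∈ Q.support, ∀ i ∈ S, k i = 0) :
    chartTransform q S j (P * Q) = chartTransform q S j P * Q := by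
  have hP : P = ∑ e ∈ P.support, monomial e (coeff e P) := P.as_sum
  have hQ' : Q = ∑ k ∈ Q.support, monomial k (coeff k Q) := Q.as_sum
  conv_lhs => rw [hP, hQ', Finset.sum_mul_sum]
  conv_rhs => rw [hQ', chartTransform_eq_sum_of_subset q S j P (Finset.Subset.refl _),
    Finset.sum_mul_sum]
  rw [chartTransform_sum]
  refine Finset.sum_congr rfl fun e _ => ?_
  rw [chartTransform_sum]
  refine Finset.sum_congr rfl fun k hk => ?_
  rw [monomial_mul, monomial_mul, chartTransform_monomial, chartExponent_add_offS hj q e k (hQ k hk)]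

/-- **The chart transform of a translated monomial** (translation off `S`, chart `j ∈ S`).
[folklore] -/
theorem chartTransform_translate_monomial {S : Finset σ} {j : σ} (hj : j ∈ S) (q : ℕ) (c : σ → K)
    (hc : ∀ i ∈ S, c i = 0) (d : σ →₀ ℕ) (a : K) :
    chartTransform q S j (PointBlowup.translate c (monomial d a)) =
      PointBlowup.translate c (monomial (chartExponent q S j d) a) := by
  set dS := d.filter (fun i => i ∈ S) with hdS
  set dN := d.filter (fun i => i ∉ S) with hdN
  have hd : d = dS + dN := (Finsupp.filter_add_filter_not d (fun i => i ∈ S)).symm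
  have hdN0 : ∀ i ∈ S, dN i = 0 := fun i hi => by
    rw [hdN, Finsupp.filter_apply, if_neg (not_not_intro hi)]
  have hdS0 : ∀ i, i ∉ S → dS i = 0 := fun i hi => by
    rw [hdS, Finsupp.filter_apply, if_neg hi]
  have hsplit : monomial d a = monomial dS a * monomial dN (1 : K) := by
    rw [monomial_mul, mul_one, ← hd]
  have hsplit' : monomial (chartExponent q S j d) a =
      monomial (chartExponent q S j dS) a * monomial dN (1 : K) := by
    rw [monomial_mul, mul_one, hd, chartExponent_add_offS hj q dS dN hdN0]
  have hQ : ∀ k ∈ (PointBlowup.translate c (monomial dN (1 : K))).support, ∀ i ∈ S, k i = 0 := by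
    intro k hk i hi
    have hle := PointBlowup.le_of_coeff_translate_monomial_ne_zero c (MvPolynomial.mem_support_iff.mp hk)
    have := Finsupp.le_def.mp hle i
    rw [hdN0 i hi] at this; omega
  have hfixS : PointBlowup.translate c (monomial dS a) = monomial dS a :=
    translate_monomial_eq_self c dS a fun i => by
      by_cases hi : i ∈ S
      · exact Or.inl (hc i hi)
      · exact Or.inr (hdS0 i hi)
  have hfixS' : PointBlowup.translate c (monomial (chartExponent q S j dS) a) =
      monomial (chartExponent q S j dS) a :=
    translate_monomial_eq_self c _ a fun i => by
      by_cases hi : i ∈ S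
      · exact Or.inl (hc i hi)
      · right
        rw [chartExponent_apply_of_ne q S (show i ≠ j from fun h => hi (h ▸ hj)) dS]
        exact hdS0 i hi
  rw [hsplit, hsplit', translate_mul, translate_mul, hfixS, hfixS',
    chartTransform_mul_offS hj q _ _ hQ, chartTransform_monomial]

/-- **A translation along the centre commutes with the `C_S`-chart transform**: for `c` supported
off `S` and `j ∈ S`, `chartTransform q S j (translate c P) = translate c (chartTransform q S j P)`
(an exact polynomial identity: every field, every `q`). [folklore] -/
theorem chartTransform_translate {S : Finset σ} {j : σ} (hj : j ∈ S) (q : ℕ) (c : σ → K)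
    (hc : ∀ i ∈ S, c i = 0) (P : MvPolynomial σ K) :
    chartTransform q S j (PointBlowup.translate c P) = PointBlowup.translate c (chartTransform q S j P) := by
  conv_lhs => rw [PointBlowup.translate_eq_sum_support c P, chartTransform_sum]
  conv_rhs => rw [chartTransform_eq_sum_of_subset q S j P (Finset.Subset.refl _),
    PointBlowup.translate_finset_sum]
  exact Finset.sum_congr rfl fun d _ => chartTransform_translate_monomial hj q c hc d _

/-- A monomial of `translate c P` lies below a monomial of `P` and agrees with it at every
untranslated variable. [folklore] -/
theorem exists_of_mem_support_translate (c : σ → K) (P : MvPolynomial σ K) {β : σ →₀ ℕ}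
    (hβ : β ∈ (PointBlowup.translate c P).support) :
    ∃ d ∈ P.support, β ≤ d ∧ ∀ i, c i = 0 → β i = d i := by
  rw [MvPolynomial.mem_support_iff, PointBlowup.translate_eq_sum_support, coeff_sum] at hβ
  obtain ⟨d, hd, hne⟩ := Finset.exists_ne_zero_of_sum_ne_zero hβ
  exact ⟨d, hd, PointBlowup.le_of_coeff_translate_monomial_ne_zero c hne,
    fun i hi => PointBlowup.apply_eq_of_coeff_translate_monomial_ne_zero c hi hne⟩

omit [Fintype σ] [DecidableEq σ] in
/-- Exponents agreeing on `S` have the same `S`-degree. [folklore] -/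
theorem degIn_eq_of_forall {S : Finset σ} {β d : σ →₀ ℕ} (h : ∀ i ∈ S, β i = d i) :
    degIn S β = degIn S d :=
  Finset.sum_congr rfl fun i hi => h i hi

/-- **A monomial of least `S`-degree whose coefficient survives the translation** (`c` supported off
`S`): one of largest total degree among the monomials of least `S`-degree — no other monomial of `P`
lies above it with the same untranslated exponents. [folklore] -/
theorem exists_ordAlong_eq_coeff_translate_eq {S : Finset σ} (c : σ → K) (hc : ∀ i ∈ S, c i = 0)
    {P : MvPolynomial σ K} (hP : P ≠ 0) :
    ∃ d₀ ∈ P.support, ordAlong S P = (degIn S d₀ : ℕ∞) ∧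
      coeff d₀ (PointBlowup.translate c P) = coeff d₀ P := by
  obtain ⟨d₁, hd₁, hd₁eq⟩ := exists_mem_support_ordAlong_eq S hP
  set T := P.support.filter fun d => degIn S d = degIn S d₁ with hT
  have hTne : T.Nonempty := ⟨d₁, Finset.mem_filter.mpr ⟨hd₁, rfl⟩⟩
  obtain ⟨d₀, hd₀T, hmax⟩ := Finset.exists_max_image T (fun d => d.degree) hTne
  obtain ⟨hd₀, hd₀deg⟩ := Finset.mem_filter.mp hd₀T
  refine ⟨d₀, hd₀, by rw [hd₁eq, hd₀deg], ?_⟩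
  rw [PointBlowup.translate_eq_sum_support, coeff_sum, Finset.sum_eq_single d₀]
  · exact WeightedBlowup.coeff_translate_monomial_self c d₀ _
  · intro d hd hne
    by_contra h
    have hle : d₀ ≤ d := PointBlowup.le_of_coeff_translate_monomial_ne_zero c h
    have hS : ∀ i ∈ S, d₀ i = d i := fun i hi =>
      PointBlowup.apply_eq_of_coeff_translate_monomial_ne_zero c (hc i hi) h
    have hdT : d ∈ T := Finset.mem_filter.mpr ⟨hd, by rw [← degIn_eq_of_forall hS, hd₀deg]⟩
    have hdeg : d.degree ≤ d₀.degree := hmax d hdT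
    rcases hle.lt_or_eq with hlt | heq
    · exact absurd (PointBlowup.degree_lt_degree_of_lt hlt) (not_lt.mpr hdeg)
    · exact hne heq.symm
  · intro h; exact (h hd₀).elim

/-- **The order along the centre is invariant under translations along the centre.** [folklore] -/
theorem ordAlong_translate {S : Finset σ} (c : σ → K) (hc : ∀ i ∈ S, c i = 0)
    (P : MvPolynomial σ K) : ordAlong S (PointBlowup.translate c P) = ordAlong S P := by
  by_cases hP : P = 0
  · subst hP; unfold PointBlowup.translate; rw [map_zero]
  refine le_antisymm ?_ ?_
  · obtain ⟨d₀, hd₀, hord, hcoeff⟩ := exists_ordAlong_eq_coeff_translate_eq c hc hP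
    rw [hord]
    exact ordAlong_le_of_coeff_ne_zero (by rw [hcoeff]; exact MvPolynomial.mem_support_iff.mp hd₀)
  · refine le_ordAlong_iff.mpr fun β hβ => ?_
    obtain ⟨d, hd, -, hS⟩ := exists_of_mem_support_translate c P hβ
    rw [degIn_eq_of_forall (fun i hi => hS i (hc i hi))]
    exact ordAlong_le_of_mem_support hd

omit [Fintype σ] in
/-- The support of the cleaned polynomial is contained in the support. [folklore] -/
theorem mem_support_of_mem_support_deletePthPowers (q : ℕ) {P : MvPolynomial σ K} {d : σ →₀ ℕ}
    (hd : d ∈ (deletePthPowers q P).support) : d ∈ P.support ∧ ¬ IsPthPowerExponent q d := by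
  rw [MvPolynomial.mem_support_iff, coeff_deletePthPowers] at hd
  by_cases h : IsPthPowerExponent q d
  · rw [if_pos h] at hd; exact (hd rfl).elim
  · rw [if_neg h] at hd; exact ⟨MvPolynomial.mem_support_iff.mpr hd, h⟩

/-- … and, for a CLEAN `F`, also under the re-cleaning after the translation (the surviving monomial
of least `S`-degree is not a `q`-th power). [folklore] -/
theorem ordAlong_deletePthPowers_translate {S : Finset σ} (q : ℕ) (c : σ → K)
    (hc : ∀ i ∈ S, c i = 0) {P : MvPolynomial σ K} (hclean : deletePthPowers q P = P) :
    ordAlong S (deletePthPowers q (PointBlowup.translate c P)) = ordAlong S P := by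
  by_cases hP : P = 0
  · subst hP; unfold PointBlowup.translate; rw [map_zero, deletePthPowers_zero]
  refine le_antisymm ?_ ?_
  · obtain ⟨d₀, hd₀, hord, hcoeff⟩ := exists_ordAlong_eq_coeff_translate_eq c hc hP
    rw [hord]
    refine ordAlong_le_of_coeff_ne_zero ?_
    rw [coeff_deletePthPowers, if_neg (PointBlowup.not_isPthPowerExponent_of_clean q hclean hd₀), hcoeff]
    exact MvPolynomial.mem_support_iff.mp hd₀
  · refine le_ordAlong_iff.mpr fun β hβ => ?_
    obtain ⟨d, hd, -, hS⟩ := exists_of_mem_support_translate c P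
      (mem_support_of_mem_support_deletePthPowers q hβ).1
    rw [degIn_eq_of_forall (fun i hi => hS i (hc i hi))]
    exact ordAlong_le_of_mem_support hd

end OffS

/-! ## 2. Cleaning the input of a step does not change its (cleaned) output -/

section Clean

variable {σ : Type*} {K : Type*} [Field K] [Fintype σ] [DecidableEq σ]
variable (p : ℕ) [hp : Fact p.Prime] [CharP K p]

omit [Fintype σ] hp [CharP K p] in
/-- The chart law maps `q`-th power exponents to `q`-th power exponents. [folklore] -/
theorem isPthPowerExponent_chartExponent (q : ℕ) (S : Finset σ) (j : σ) {d : σ →₀ ℕ}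
    (hd : IsPthPowerExponent q d) : IsPthPowerExponent q (chartExponent q S j d) := by
  rw [isPthPowerExponent_iff] at hd ⊢
  intro i
  rw [chartExponent_apply]
  split_ifs
  · exact Nat.dvd_sub (Finset.dvd_sum fun i _ => hd i) (dvd_refl q)
  · exact hd i

omit [Fintype σ] [DecidableEq σ] in
/-- In characteristic `p`, the translate of a `pⁿ`-th power monomial has no monomial surviving the
cleaning: `deletePthPowers (pⁿ) (translate b (a·y^D)) = 0` for `pⁿ ∣ D`. [folklore] -/
theorem deletePthPowers_translate_monomial_eq_zero (n : ℕ) (b : σ → K) {D : σ →₀ ℕ}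
    (hD : IsPthPowerExponent (p ^ n) D) (a : K) :
    deletePthPowers (p ^ n) (PointBlowup.translate b (monomial D a)) = 0 := by
  classical
  -- `D = pⁿ • e`
  have hDe : D = p ^ n • Finsupp.mapRange (· / p ^ n) (Nat.zero_div _) D := by
    ext i
    simp only [Finsupp.coe_smul, Pi.smul_apply, smul_eq_mul, Finsupp.mapRange_apply]
    exact (Nat.mul_div_cancel' ((isPthPowerExponent_iff _ _).mp hD i)).symm
  set e := Finsupp.mapRange (· / p ^ n) (Nat.zero_div _) D with he
  have hM : (monomial D a : MvPolynomial σ K) = C a * (monomial e (1 : K)) ^ (p ^ n) := by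
    rw [monomial_pow, one_pow, C_mul_monomial, mul_one, ← hDe]
  have hpow : PointBlowup.translate b ((monomial e (1 : K)) ^ (p ^ n)) =
      (PointBlowup.translate b (monomial e (1 : K))) ^ (p ^ n) := by
    unfold PointBlowup.translate
    rw [map_pow]
  rw [hM, PointBlowup.translate_C_mul, hpow, pow_char_pow_eq_sum_monomial p n, Finset.mul_sum,
    deletePthPowers_finset_sum]
  refine Finset.sum_eq_zero fun d _ => ?_
  rw [C_mul_monomial, deletePthPowers_monomial, if_pos]
  exact fun i _ => ⟨d i, by simp⟩

omit [Fintype σ] in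
/-- **Cleaning the input of a step does not change its cleaned output** (`q = pⁿ`, characteristic
`p`): the `q`-th power monomials of `T` go to `q`-th power monomials under the chart transform, to
`q`-th powers of polynomials under the translation (Frobenius), and are then deleted. [folklore] -/
theorem deletePthPowers_translate_chartTransform_deletePthPowers (n : ℕ) (S : Finset σ) (j : σ)
    (b : σ → K) (T : MvPolynomial σ K) :
    deletePthPowers (p ^ n) (PointBlowup.translate b (chartTransform (p ^ n) S j
        (deletePthPowers (p ^ n) T))) =
      deletePthPowers (p ^ n) (PointBlowup.translate b (chartTransform (p ^ n) S j T)) := by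
  have hsplit : T = deletePthPowers (p ^ n) T +
      ∑ d ∈ T.support with IsPthPowerExponent (p ^ n) d, monomial d (coeff d T) := by
    unfold deletePthPowers
    rw [add_comm, Finset.sum_filter_add_sum_filter_not]
    exact T.as_sum
  conv_rhs => rw [hsplit]
  rw [chartTransform_add, translate_add, deletePthPowers_add, chartTransform_sum,
    PointBlowup.translate_finset_sum, deletePthPowers_finset_sum, Finset.sum_eq_zero, add_zero]
  intro d hd
  rw [chartTransform_monomial]
  exact deletePthPowers_translate_monomial_eq_zero p n b
    (isPthPowerExponent_chartExponent (p ^ n) S j (Finset.mem_filter.mp hd).2) _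

end Clean

/-! ## 3. The step at a translated point is the step, at a fibre point, of the moved state -/

section Step

variable {σ : Type*} {K : Type*} [Field K] [Fintype σ] [DecidableEq σ] [DecidableEq K]

/-- **The blow-up step at a point `b' + c` along the centre** (`j ∈ S`, `b'` supported in `S`, `c`
supported off `S`) is the step at the fibre point `b'` of the state MOVED TO THE POINT `c` OF THE
CENTRE (residual polynomial translated by `c`; the components `{y_i = 0}`, `c_i ≠ 0`, do not pass
through `c` and are lost). Exact identity, every field, every `q`, no permissibility hypothesis; the
moved state is NOT re-cleaned here (see `step_add_eq_step_translate_clean`). [folklore] -/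
theorem step_add_eq_step_translate (q : ℕ) {S : Finset σ} {j : σ} (hj : j ∈ S) (b' c : σ → K)
    (hb' : ∀ i, i ∉ S → b' i = 0) (hc : ∀ i ∈ S, c i = 0) (s : CState σ K) :
    step q S j (b' + c) s =
      step q S j b' ⟨PointBlowup.translate c s.F, s.r.filter (fun i => c i = 0),
        s.exc.filter (fun i => c i = 0)⟩ := by
  have hiff : ∀ i, (b' + c) i = 0 ↔ c i = 0 ∧ b' i = 0 := fun i => by
    rw [Pi.add_apply]
    by_cases hi : i ∈ S
    · rw [hc i hi, add_zero]; exact ⟨fun h => ⟨rfl, h⟩, fun h => h.2⟩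
    · rw [hb' i hi, zero_add]; exact ⟨fun h => ⟨h, rfl⟩, fun h => h.1⟩
  simp only [step, CState.mk.injEq]
  refine ⟨?_, ?_, ?_⟩
  · unfold pointTransform
    rw [chartTransform_translate hj q c hc, translate_translate]
  · unfold newMult
    rw [ordAlong_translate c hc]
    congr 1
    ext i
    simp only [Finsupp.filter_apply]
    by_cases h1 : c i = 0 <;> by_cases h2 : b' i = 0
    · rw [if_pos ((hiff i).mpr ⟨h1, h2⟩), if_pos h2, if_pos h1]
    · rw [if_neg (fun h => h2 ((hiff i).mp h).2), if_neg h2]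
    · rw [if_neg (fun h => h1 ((hiff i).mp h).1), if_pos h2, if_neg h1]
    · rw [if_neg (fun h => h2 ((hiff i).mp h).2), if_neg h2]
  · unfold newExc
    congr 1
    ext i
    simp only [Finset.mem_filter, hiff i]
    tauto

/-- **The same with the moved state re-cleaned** (`q = pⁿ`, characteristic `p`, `F` clean): the
step at `b' + c` is the step at the fibre point `b'` of `⟨deletePthPowers q (translate c F), r|_{c=0},
exc|_{c=0}⟩`, the presented state of the SAME hypersurface `x^q + F` at the point `c` of the centre
(translation, cleaning `x ↦ x − (q-th roots)`, components through `c`). [folklore] -/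
theorem step_add_eq_step_translate_clean (p : ℕ) [Fact p.Prime] [CharP K p] (n : ℕ) {S : Finset σ}
    {j : σ} (hj : j ∈ S) (b' c : σ → K) (hb' : ∀ i, i ∉ S → b' i = 0) (hc : ∀ i ∈ S, c i = 0)
    (s : CState σ K) (hclean : deletePthPowers (p ^ n) s.F = s.F) :
    step (p ^ n) S j (b' + c) s =
      step (p ^ n) S j b' ⟨deletePthPowers (p ^ n) (PointBlowup.translate c s.F),
        s.r.filter (fun i => c i = 0), s.exc.filter (fun i => c i = 0)⟩ := by
  rw [step_add_eq_step_translate (p ^ n) hj b' c hb' hc s]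
  simp only [step, CState.mk.injEq]
  refine ⟨?_, ?_, rfl⟩
  · unfold pointTransform
    exact (deletePthPowers_translate_chartTransform_deletePthPowers p n S j b' _).symm
  · unfold newMult
    rw [ordAlong_deletePthPowers_translate (p ^ n) c hc hclean, ordAlong_translate c hc]

end Step

end MohAlong

end Summit.ResolutionOfSingularities.ResolutionOfSingularities.Theorems.PIDim4

end
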